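import Literature.Geometry.Kaehler.HolomorphicChainRectifiable
import Literature.Geometry.Kaehler.HolomorphicChainBlowUp
import HarnessLib

/-!
# Blow-ups of a holomorphic chain have finite mass and summable data, from Lelong's theorem

The flat estimates for the blow-ups `D_r = (1/r)_*(τ_{-b})_*[T]` of a holomorphic chain
(`HolomorphicChainConeDefect.lean`) take as hypotheses that `D_r` has finite mass on `B(0,1)`:
`𝓗^{2p}(W_r) < ∞` and `θ_r ξ_r` is `𝓗^{2p} ⌞ W_r`-integrable, `W_r = {y : b + r y ∈ reg|T|} ∩ B(0,1)`.
Both follow from Lelong's theorem (the named fact `Lelong1957_hausdorffMeasure_inter_lt_top`,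
through `HolomorphicChain.measure_carrier_inter_lt_top_of_lelong`, the bound
`HolomorphicChain.exists_forall_abs_density_le` on the density over a compact ball, and the
measurability results of `HolomorphicChainRectifiable.lean`), once `𝐁(b, r) ⊆ Ω`:

* `HolomorphicChain.measure_blowUp_carrier_lt_top_of_lelong` — `𝓗^{2p}(W_r) = r^{-2p} 𝓗^{2p}(reg|T| ∩ B(b,r)) < ∞`;
* `HolomorphicChain.integrable_blowUp_data_of_lelong` — `θ_r ξ_r ∈ L¹(𝓗^{2p} ⌞ W_r)`.

No definitions, no named facts.

## References

* R. Harvey, *Holomorphic chains and their boundaries*, PSPUM XXX.1 (1977), Lemma 1.3, §1.10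
  [Harvey1977].
-/

open scoped Manifold ContDiff Topology ENNReal Pointwise
open Set Filter MeasureTheory

namespace Literature.Geometry.Kaehler

open Literature.Geometry.GeometricMeasureTheory

-- Nested operator-norm instances on `Covector V m`, as in `Currents.lean`.
set_option maxSynthPendingDepth 2

universe u

variable {V : Type u} [NormedAddCommGroup V] [InnerProductSpace ℂ V] [FiniteDimensional ℂ V]
  [MeasurableSpace V] [BorelSpace V] {Ω : TopologicalSpace.Opens V} {p : ℕ}

omit [FiniteDimensional ℂ V] [MeasurableSpace V] [BorelSpace V] in
/-- The carrier of the blow-up is the pull-back of the cut-down carrier: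
`{y : b + r y ∈ reg|T|} ∩ B(0,1) = A_r⁻¹(reg|T| ∩ B(b,r))`. [folklore] -/
theorem HolomorphicChain.blowUp_carrier_eq (T : HolomorphicChain 𝓘(ℂ, V) Ω p) (b : V) {r : ℝ} (hr : 0 < r) :
    (fun y : V => b + r • y) ⁻¹' T.carrier ∩ Metric.ball (0 : V) 1 =
      (fun y : V => b + r • y) ⁻¹' (T.carrier ∩ Metric.ball b r) := by
  ext y
  simp only [mem_inter_iff, mem_preimage, Metric.mem_ball, dist_eq_norm, sub_zero,
    add_sub_cancel_left, norm_smul, Real.norm_of_nonneg hr.le]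
  constructor
  · rintro ⟨h1, h2⟩
    exact ⟨h1, by nlinarith⟩
  · rintro ⟨h1, h2⟩
    exact ⟨h1, by nlinarith⟩

/-- **`𝓗^{2p}(W_r) < ∞` from Lelong's theorem**: the carrier
`W_r = {y : b + r y ∈ reg|T|} ∩ B(0,1)` of the blow-up `D_r` has
`𝓗^{2p}(W_r) = r^{-2p} 𝓗^{2p}(reg|T| ∩ B(b,r)) ≤ r^{-2p} 𝓗^{2p}(reg|T| ∩ 𝐁(b,r)) < ∞` when
`𝐁(b,r) ⊆ Ω`. [cite: Harvey1977, Lemma 1.3] -/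
theorem HolomorphicChain.measure_blowUp_carrier_lt_top_of_lelong
    (hL : Lelong1957_hausdorffMeasure_inter_lt_top.{u}) (T : HolomorphicChain 𝓘(ℂ, V) Ω p) {b : V}
    {r : ℝ} (hr : 0 < r) (hball : Metric.closedBall b r ⊆ (Ω : Set V)) :
    (μHE[2 * p] : Measure V) ((fun y : V => b + r • y) ⁻¹' T.carrier ∩ Metric.ball (0 : V) 1) < ⊤ := by
  rw [T.blowUp_carrier_eq b hr, euclideanHausdorffMeasure_preimage_add_smul b hr]
  refine ENNReal.mul_lt_top ENNReal.ofReal_lt_top ?_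
  exact lt_of_le_of_lt (measure_mono (Set.inter_subset_inter_right _ Metric.ball_subset_closedBall))
    (T.measure_carrier_inter_lt_top_of_lelong hL (isCompact_closedBall b r) hball)

/-- **Summability of the blown-up data from Lelong's theorem**: `θ_T(b + r ·) ξ_T(b + r ·)` is
`𝓗^{2p} ⌞ W_r`-integrable when `𝐁(b,r) ⊆ Ω` — the density is bounded on the compact ball
(`exists_forall_abs_density_le`), the orientation `2p`-vector has norm `≤ 1`, the integrand is
a.e. strongly measurable (transported from `HolomorphicChainRectifiable.lean`), and
`𝓗^{2p}(W_r) < ∞`. [cite: Harvey1977, Lemma 1.3] -/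
theorem HolomorphicChain.integrable_blowUp_data_of_lelong
    (hL : Lelong1957_hausdorffMeasure_inter_lt_top.{u}) (T : HolomorphicChain 𝓘(ℂ, V) Ω p) {b : V}
    {r : ℝ} (hr : 0 < r) (hball : Metric.closedBall b r ⊆ (Ω : Set V)) :
    Integrable (fun y => ((T.density (b + r • y) : ℤ) : ℝ) • frameVector (T.orientationFrame (b + r • y)))
      ((μHE[2 * p] : Measure V).restrict ((fun y : V => b + r • y) ⁻¹' T.carrier ∩ Metric.ball (0 : V) 1)) := by
  have hmeasA : Measurable (fun y : V => b + r • y) := (measurable_const_smul r).const_add b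
  set W : Set V := (fun y : V => b + r • y) ⁻¹' T.carrier ∩ Metric.ball (0 : V) 1 with hW
  have hWeq : W = (fun y : V => b + r • y) ⁻¹' (T.carrier ∩ Metric.ball b r) := T.blowUp_carrier_eq b hr
  haveI : IsFiniteMeasure ((μHE[2 * p] : Measure V).restrict W) :=
    ⟨by rw [Measure.restrict_apply_univ]; exact T.measure_blowUp_carrier_lt_top_of_lelong hL hr hball⟩
  -- a.e. strong measurability, transported under `A_r`
  have hsm : AEStronglyMeasurable
      (fun y => ((T.density (b + r • y) : ℤ) : ℝ) • frameVector (T.orientationFrame (b + r • y)))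
      ((μHE[2 * p] : Measure V).restrict W) := by
    have h0 : AEStronglyMeasurable
        (fun x => (T.density x : ℝ) • frameVector (T.orientationFrame x))
        ((μHE[2 * p] : Measure V).restrict T.carrier) := by
      have h1 : Measurable fun x => (T.density x : ℝ) :=
        (measurable_of_countable (Int.cast : ℤ → ℝ)).comp T.measurable_density
      exact h1.aestronglyMeasurable.smul T.aestronglyMeasurable_frameVector_orientationFrame
    have h0' : AEStronglyMeasurable
        (fun x => (T.density x : ℝ) • frameVector (T.orientationFrame x))
        (Measure.map (fun y : V => b + r • y) ((μHE[2 * p] : Measure V).restrict W)) := by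
      rw [hWeq, map_add_smul_restrict_preimage b hr]
      exact (h0.mono_measure (Measure.restrict_mono Set.inter_subset_left le_rfl)).smul_measure _
    exact h0'.comp_measurable hmeasA
  -- a uniform bound on the compact ball
  obtain ⟨M, hM⟩ := T.exists_forall_abs_density_le (isCompact_closedBall b r) hball
  refine ⟨hsm, ?_⟩
  refine HasFiniteIntegral.of_bounded (C := max M 0) ?_
  filter_upwards [ae_restrict_mem ((T.measurableSet_carrier.preimage hmeasA).inter
    Metric.isOpen_ball.measurableSet)] with y hy
  have hyb : b + r • y ∈ Metric.closedBall b r := by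
    rw [Metric.mem_closedBall, dist_eq_norm, add_sub_cancel_left, norm_smul, Real.norm_of_nonneg hr.le]
    have : ‖y‖ < 1 := mem_ball_zero_iff.1 hy.2
    nlinarith
  calc ‖((T.density (b + r • y) : ℤ) : ℝ) • frameVector (T.orientationFrame (b + r • y))‖
      = |(T.density (b + r • y) : ℝ)| * ‖frameVector (T.orientationFrame (b + r • y))‖ := by
        rw [norm_smul, Real.norm_eq_abs]
    _ ≤ max M 0 * 1 := mul_le_mul ((hM _ hyb).trans (le_max_left _ _))
        (T.norm_frameVector_orientationFrame_le_one _) (norm_nonneg _) (le_max_right _ _)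
    _ = max M 0 := mul_one _

end Literature.Geometry.Kaehler
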